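import Summits.BirchSwinnertonDyer.BirchSwinnertonDyer.Theorems.Rank2ObservatoryCubicFieldR216788
import HarnessLib

/-!
# BirchSwinnertonDyer — rank ≥ 2 observatory: class number one of the cubic field of `-87 + 109 * X - 21 * X ^ 2 + X ^ 3` (`Δ = 216788`) — certificates at the primes 113, 127, 131

HONEST FRAMING: per-curve certified theorems and census instruments; no claim on BSD in rank ≥ 2.

Companion of the per-FIELD file `Rank2ObservatoryCubicFieldR216788` of the KERNEL-2DESC instrument (design
`b2b-bsdr2-cert-3/KERNEL-2DESC.md` §9e–§9g): the degree-one prime-element certificates at the primes 113, 127, 131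
(part b). Split off for file size; generated by the same generator from the same checked data.
Sorry-free; axioms `propext`, `Classical.choice`, `Quot.sound`.
[cite: Marcus2018, Ch. 3 Thm. 27, Ch. 5 Cor. 2 of Thm. 37]
-/

-- single-conjunct summit: `Summit.BirchSwinnertonDyer.BirchSwinnertonDyer.…` repeats the name by design
set_option linter.dupNamespace false

noncomputable section

open scoped Classical NumberField

open Literature.NumberTheory.NumberFields Polynomial Module NumberField

namespace Summit.BirchSwinnertonDyer.BirchSwinnertonDyer.Rank2Observatory.TwoDescCubic

namespace FieldR216788

/-! ## Class number one -/

/-- Certificate at `113`: every ring map `ψ : 𝓞 K → ℤ/113` kills a prime element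
(`α ↦ 74`: `1153 - 326 * α + 18 * α ^ 2` (norm `113`)). [cite: Marcus2018, Ch. 3, Thm. 27] -/
theorem cert113 (ψ : 𝓞 (CubicField (-21) 109 (-87)) →+* ZMod 113) : ∃ e : 𝓞 (CubicField (-21) 109 (-87)), ψ e = 0 ∧ Prime e := by
  refine cert_of_cases aeval_α ψ (fun t ht hF => ?_)
  have hroots : ∀ t : ZMod 113,
      t ^ 3 + (((-21) : ℤ) : ZMod 113) * t ^ 2 + ((109 : ℤ) : ZMod 113) * t + (((-87) : ℤ) : ZMod 113) = 0 → t = 74 := by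
    decide +kernel
  obtain rfl := hroots t hF
  exact ⟨lin aeval_α 1153 (-326) 18, by simp only [lin, map_add, map_mul, map_pow, map_intCast, ht]; decide,
      lin_prime_of_prime irreducible aeval_α finrank_eq 1153 (-326) 18 (n := 113)
        (by norm_num [MonicCubic.normForm]) (by norm_num)⟩

/-- Certificate at `127`: every ring map `ψ : 𝓞 K → ℤ/127` kills a prime element
(`α ↦ 111`: `-10 + 15 * α - 2 * α ^ 2` (norm `-127`)). [cite: Marcus2018, Ch. 3, Thm. 27] -/
theorem cert127 (ψ : 𝓞 (CubicField (-21) 109 (-87)) →+* ZMod 127) : ∃ e : 𝓞 (CubicField (-21) 109 (-87)), ψ e = 0 ∧ Prime e := by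
  refine cert_of_cases aeval_α ψ (fun t ht hF => ?_)
  have hroots : ∀ t : ZMod 127,
      t ^ 3 + (((-21) : ℤ) : ZMod 127) * t ^ 2 + ((109 : ℤ) : ZMod 127) * t + (((-87) : ℤ) : ZMod 127) = 0 → t = 111 := by
    decide +kernel
  obtain rfl := hroots t hF
  exact ⟨lin aeval_α (-10) 15 (-2), by simp only [lin, map_add, map_mul, map_pow, map_intCast, ht]; decide,
      lin_prime_of_prime irreducible aeval_α finrank_eq (-10) 15 (-2) (n := (-127))
        (by norm_num [MonicCubic.normForm]) (by norm_num)⟩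

/-- Certificate at `131`: `g` has no root mod `131`, so there is no ring map `𝓞 K → ℤ/131`. [folklore] -/
theorem cert131 (ψ : 𝓞 (CubicField (-21) 109 (-87)) →+* ZMod 131) : ∃ e : 𝓞 (CubicField (-21) 109 (-87)), ψ e = 0 ∧ Prime e :=
  cert_of_no_root aeval_α ψ (by decide +kernel)

end FieldR216788

end Summit.BirchSwinnertonDyer.BirchSwinnertonDyer.Rank2Observatory.TwoDescCubic

end
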